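import Summits.CriticalPhenomena.PercolationContinuityZ3.Theorems.PercNearOneGluingNoHeavyQuantFarKronF41S6
import Summits.CriticalPhenomena.PercolationContinuityZ3.Theorems.PercNearOneGluingNoHeavyQuantFarLeFive
import Summits.CriticalPhenomena.PercolationContinuityZ3.Theorems.PercNearOneGluingNoHeavyLowerTailTwoCopyFin6
import HarnessLib

/-!
# FAR (`Quant.FarRelayRow`) at layer `1` with four relays on at most SIX vertices

builds on p205010 (kernel theorem, internal audit signed; external expert review pending)

Support file (`--supports stmt-CriticalPhenomena-4575`), seat `prim-cert-1` (gen 9).  COMPUTATIONAL by inheritance (the Kronecker-checked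
certificate instance `FarKron.f41s6_check` and the `K5` instance use `native_decide`).
* `TwoCopy.farp_four_one_of_card_le_six` — FAR for `|A| = 4`, `j = 1` on every weighted graph with `n ≤ 6` vertices
  (`o ∉ A`: `n = 5` by the `K5` certificate `farp_four_one_fin5`, `n = 6` by the Kronecker-checked `K6` certificate `farp_four_one_fin6`);
in `Quant.FarRelayRow`'s exact shape: `farRelayRow_four_one_of_card_le_six`.
(`|A| = 3`, `j = 1` — `Z(3,2)` — has NO plain two-copy certificate on six vertices, kit j099102; nor has `|A| = 5`, `j = 2`, kit j099101.)
[cite: KozmaNitzan2024, Lemma 2 (p. 6), Conjecture 3 (p. 15)] (context; FAR is this programme's statement).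
-/

namespace Summit.CriticalPhenomena.PercolationContinuityZ3.Theorems.TwoCopy

open Finset MeasureTheory
open Literature.Probability.Percolation Literature.Probability.LatticeModels
open Summit.CriticalPhenomena.PercolationContinuityZ3.Theorems.AdditiveGluing.Negative.Cert
open scoped Classical

variable {n : ℕ}

/-- Generic weights give coordinates strictly inside the unit cube (prim-cert-2's coordinates `OneCutCert.xOf`). [this work] -/
theorem xOf_open_of_generic {k : ℕ} (w : Sym2 (Fin k) → unitInterval) (hg : OneCutCert.Generic w) :
    ∀ i, 0 < OneCutCert.xOf w i ∧ OneCutCert.xOf w i < 1 := by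
  intro i
  have hnd : ¬ (OneCutCert.edgeE k i).IsDiag := (OneCutCert.mem_range_edgeE (OneCutCert.edgeE k i)).1 ⟨i, rfl⟩
  obtain ⟨h0, -, h1⟩ := hg _ hnd
  exact ⟨lt_of_le_of_ne (w _).2.1 (Ne.symm h0), lt_of_le_of_ne (w _).2.2 h1⟩

/-- `[1,2,3,4]` enumerates `univ ∖ {0, 5}` in `Fin 6`. [this work] -/
theorem toFinset_f41s6_rel : FarKron.f41s6_rel.toFinset = ((Finset.univ : Finset (Fin 6)).erase 5).erase 0 := by decide

/-- **FAR `|A| = 4`, `j = 1`, `o ∉ A` on `Fin 6`** (one Steiner vertex), every weight vector. [this work] -/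
theorem farp_four_one_fin6 (w : Sym2 (Fin 6) → unitInterval) (A : Finset (Fin 6)) (o : Fin 6) (hoA : o ∉ A)
    (hA : A.card = 4) : FARp w A o 1 := by
  have hcardI : (insert o A).card = 5 := by rw [Finset.card_insert_of_notMem hoA, hA]
  have hAc : (insert o A)ᶜ.card = 1 := by rw [Finset.card_compl, hcardI]; simp
  obtain ⟨f, hf⟩ := Finset.card_eq_one.1 hAc
  have hfI : f ∉ insert o A := by
    have : f ∈ (insert o A)ᶜ := by rw [hf]; exact Finset.mem_singleton_self f
    exact Finset.mem_compl.1 this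
  have hof : o ≠ f := fun h => hfI (h ▸ Finset.mem_insert_self o A)
  have hR : A = ((Finset.univ : Finset (Fin 6)).erase f).erase o := by
    ext x
    rw [Finset.mem_erase, Finset.mem_erase]
    constructor
    · intro hx
      exact ⟨fun h => hoA (h ▸ hx), fun h => hfI (h ▸ Finset.mem_insert_of_mem hx), Finset.mem_univ x⟩
    · rintro ⟨hxo, hxf, -⟩
      have hx : x ∈ insert o A := by
        by_contra hx
        have : x ∈ (insert o A)ᶜ := Finset.mem_compl.2 hx
        rw [hf, Finset.mem_singleton] at this
        exact hxf this
      rcases Finset.mem_insert.1 hx with h | h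
      · exact absurd h hxo
      · exact h
  obtain ⟨σ, hσo, hσf⟩ := exists_perm_zero_five o f hof
  have hRm : A.map σ.toEmbedding = FarKron.f41s6_rel.toFinset := by
    rw [hR, Finset.map_erase, Finset.map_erase, Finset.map_univ_equiv, toFinset_f41s6_rel, Equiv.toEmbedding_apply,
      Equiv.toEmbedding_apply, hσo, hσf]
  refine FARp.of_generic A o 1 (fun w' hg => ?_) w
  refine FARp.of_relabel σ w' A o 1 ?_
  rw [hRm, hσo]
  intro hEN t hcut
  exact FarKron.f41s6_canon (relabelW σ w') (xOf_open_of_generic _ (generic_relabelW σ w' hg))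
    (by push_cast at hEN; linarith) t (fun v hv => hcut v (List.mem_toFinset.2 hv))

/-- **FAR `|A| = 4`, `j = 1` on at most six vertices.** `o ∈ A`: elementary; `o ∉ A`: `n = 5` (`farp_four_one_fin5`, `K5` certificate)
or `n = 6` (`farp_four_one_fin6`, Kronecker-checked `K6` certificate). [this work] -/
theorem farp_four_one_of_card_le_six (hn : n ≤ 6) (w : Sym2 (Fin n) → unitInterval) (A : Finset (Fin n)) (o : Fin n)
    (hA : A.card = 4) : FARp w A o 1 := by
  by_cases hoA : o ∈ A
  · exact FARp.one_of_mem w A o hoA (by omega)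
  have hAo : A.card + 1 ≤ n := by
    have h := Finset.card_le_univ (insert o A)
    rw [Finset.card_insert_of_notMem hoA, Fintype.card_fin] at h
    exact h
  rcases (show n = 5 ∨ n = 6 by omega) with h5 | h6
  · subst h5; exact farp_four_one_fin5 w A o hoA hA
  · subst h6; exact farp_four_one_fin6 w A o hoA hA

/-- `Quant.FarRelayRow`'s instance `|A| = 4`, `j = 1` for `n ≤ 6`, exact shape. [this work] -/
theorem farRelayRow_four_one_of_card_le_six (hn : n ≤ 6) (w : Sym2 (Fin n) → unitInterval) (A : Finset (Fin n)) (o : Fin n)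
    (t : ℝ) (hA : A.card = 4) (hEN : (2 * 1 : ℝ) < ∑ a ∈ A, (prodBernoulli w).real (openConn o a))
    (hcut : ∀ a ∈ A, (prodBernoulli w).real (openConn o a)ᶜ ≤ t) :
    (prodBernoulli w).real {ω : BondConfig (Fin n) | (A.filter fun a => ω ∈ openConn o a).card ≤ 1} ≤ t :=
  farp_four_one_of_card_le_six hn w A o hA (by push_cast; linarith) t hcut

end Summit.CriticalPhenomena.PercolationContinuityZ3.Theorems.TwoCopy
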